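import Summits.ValiantsHypothesis.ValiantsHypothesis.Theorems.NewtonUnitEquationsTwoProductsRankOneOneSidedLawSliceExc
import HarnessLib

/-!
# Route NewtonUnitEquations — crux `TwoProducts` (stmt-ValiantsHypothesis-5906), line `relation_ladder`, rung R8 (ONE-SIDED rank one
# `p•α = Σ_i q_i•β_i`, any number of plus letters): the DILATED FREE LIFT with a plus-letter SET — part 4/6 — finite shift rank (T5); the planar instance `RelDataO`, the dilated push-forward `enumP`, injectivity, lifted visible points (T7)

Part 4: `Fsl_shift` with index `SIdx m (Σ_B b)` (`|SIdx m s| = 2m(s+1)² + 1`, Vandermonde for `C(λ + e, d)` via `R6b.HSD`); `piT_frM_ofFun`;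
`RelDataO u v` (`p•α = Σ_j qI j • enum j`), `idx`, `enumP`, `piE_enumP_frM`, `phi_GT`, `rhoP = mapDomain enum (ofFun qI)`,
**`injOn_of_rankOne`**, `lifted_of_visible`, letter weights `rWP`, `lwt_splitO`.

THE ONE-SIDED RANK-ONE LAW `p•α = Σ_{i<k} q_i•β_i` (R8; all `p, q_i ≥ 1`, distinct letters, every additive coincidence of the letter
family a multiple of this one relation): GLOBALLY `#visible ≤ 2^{c m}(#T + 2)^c` (`c = 1732`).  Engine (val-idea-8 g3's memo
`Cruxes/TwoProducts/Lines/relation_ladder_R8_engine.md` rev 2, typed target `Lines/relation_ladder_sketch_R8.lean :: R8.RankOneOneSidedLaw`,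
slice count `Lines/relation_ladder_R8_simplex.lean` = landed `…RankOneSimplexCount`): the DILATED FREE LIFT `α ↦ ∏ Y_j^{q_j}`, `Y_j ↦ Y_j^p` on
the plus letters, identity elsewhere, over the `p`-dilated plane (`enumP : j ↦ enum j` on the plus letters, `i ↦ p•enum i` otherwise); fibres
`k = #α` with divisibility guards `p ∣ x_j − q_j k`; letter count `B_k = k + Σ_j (x_j − q_j k)/p`; SLICING by the whole plus-letter exponent
vector `b = x|_B`; the coefficient theorem with `Pfac · C(R + B_k − 1, B_k) · κ_k`; finite SHIFT RANK `2m(Σb + 1)² + 1` and val-lit-p3's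
`ShiftRank.pencilCount` BY NAME; the slices of the visible points factor through the restricted letter multisets `L₀|_{a ∪ B}` (`deg L₀ ≤ m`),
counted by the simplex bound `#W ≤ 2^{n+k}` (`R8.card_W_le`); WIDE plus sides (`k > m + 1`), large (`> m`) or absent coefficients/letters are
permutation type (R3♯).  `k = 1` is R7c (`R7b.rankOneTwoLaw_proof`), `k = 2` is R7b (`R7b.rankOneThreeGenLaw_proof`).

AUTHORSHIP / LANE NOTE (val-lit-p3 g15, prover seat, helper mode `--supports stmt-ValiantsHypothesis-5906 --as helper`; CLAIM-FIRST #2 on the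
val-lit bus 12:55Z, silence = GO 13:30Z, no objection; the line owner val-idea-8 g3 CLOSED 12:24Z leaving R8 as a typed target + memo): part 4/6.
The STATEMENT is val-idea-8 g3's typed `R8.RankOneOneSidedLaw` (landed here by its LITERAL BODY, `OneSidedRankOne` unfolded — parameter-free
`def … : Prop` are not declared in Theorems files); the engine follows g3's memo decl-by-decl as a generalisation of the landed R7b REV 2 port
(`…RankOneThreeGenLaw*`, namespace `R7b`); the Lean text of this module is this seat's.  Reused BY NAME: `R6b.HSD` (+ closure lemmas),
`R7b.dilE`/`R7b.piT_dilE`/`R7b.piE_dilE`, `R7a.permType_of_rankOne_largeCoeff/absent`, `toolBound_mono`, `tab`, `sgn`, `R6b.sum_sgn`,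
`PlanarCell.eq_of_nsmul_eq`, `FormalLogLinearisation.wt_nsmul`, `R8.card_W_le` (simplex).  Namespace `…PermutationType.R8` (the typed target's).
Nothing here closes the line's residual (`ResidualLawV20`), the crux `TwoProducts` (5906) or `VP ≠ VNP`; no summit statement is proved.

Honest scope: TWO-SIDED relations with ≥ 2 letters on each side (e.g. `α+2β = γ+δ`, val-neg-1 g4's p635912) and coincidence rank ≥ 2 are NOT
covered.  Nothing here moves VP ≠ VNP; `TwoProducts` (5906) / `PlanarCellBound` stay OPEN. [folklore]
-/

noncomputable section

-- Sub = Summit single-conjunct layout: the duplicated namespace component is mandated by the tree.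
set_option linter.dupNamespace false
set_option linter.unusedSimpArgs false
set_option linter.unusedSectionVars false
set_option linter.unusedVariables false

namespace Summit.ValiantsHypothesis.ValiantsHypothesis.Theorems.NewtonUnitEquations.TwoProducts.PermutationType
namespace R8
open scoped BigOperators
open MvPolynomial

variable {σ : Type*} [Fintype σ] [DecidableEq σ]

variable (Io : OIdx σ)
/-! ## Part T5: finite shift rank of the slice functions (index `((Fin m ⊕ Fin m) × Fin (s+1)²) ⊕ Unit`, `s = Σ_B b`) -/

section ShiftDecomp

/-- `lam_add` — technical lemma of the R8 one-sided dilated free-lift toolkit. [folklore] -/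
theorem lam_add (β w : σ → ℕ) : lam Io (β + w) = lam Io β + lam Io w := by
  unfold lam
  simp only [Pi.add_apply, Finset.sum_add_distrib]

/-- Binomial coefficients of the additive form `λ` have shift rank `d + 1` (Vandermonde). [folklore] -/
theorem hsd_choose (e d b₀ : ℕ) (hd : d ≤ b₀) :
    R6b.HSD (Fin (b₀ + 1)) (fun ν : σ → ℕ => (((lam Io ν + e).choose d : ℕ) : ℂ)) := by
  refine ⟨fun β p => if (p : ℕ) ≤ d then (((lam Io β + e).choose p : ℕ) : ℂ) else 0,
    fun p w => (((lam Io w).choose (d - p) : ℕ) : ℂ), fun β w => ?_⟩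
  have hnat : (lam Io β + e + lam Io w).choose d =
      ∑ p ∈ Finset.range (d + 1), (lam Io β + e).choose p * (lam Io w).choose (d - p) := by
    have h := Finset.Nat.sum_antidiagonal_eq_sum_range_succ
      (fun p q => (lam Io β + e).choose p * (lam Io w).choose q) d
    rw [Nat.succ_eq_add_one] at h
    rw [← h, Nat.add_choose_eq]
  simp only
  rw [lam_add, show lam Io β + lam Io w + e = lam Io β + e + lam Io w by ring, hnat]
  push_cast
  rw [Fin.sum_univ_eq_sum_range (fun p => (if p ≤ d then (((lam Io β + e).choose p : ℕ) : ℂ) else 0) *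
      (((lam Io w).choose (d - p) : ℕ) : ℂ)) (b₀ + 1)]
  simp_rw [ite_mul, zero_mul]
  rw [← Finset.sum_filter]
  congr 1
  ext p
  simp only [Finset.mem_range, Finset.mem_filter]
  omega

/-- `restProd_add` — technical lemma of the R8 one-sided dilated free-lift toolkit. [folklore] -/
theorem restProd_add (t : σ → ℂ) (β w : σ → ℕ) : restProd Io t (β + w) = restProd Io t β * restProd Io t w := by
  unfold restProd
  rw [← Finset.prod_mul_distrib]
  exact Finset.prod_congr rfl fun j _ => by rw [Pi.add_apply, pow_add]

/-- `ind_add` — technical lemma of the R8 one-sided dilated free-lift toolkit. [folklore] -/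
theorem ind_add (β w : σ → ℕ) : ind Io (β + w) = ind Io β * ind Io w := by
  unfold ind
  simp only [Pi.add_apply]
  by_cases hβ : β Io.a = 0 ∧ ∀ j ∈ B Io, β j = 0 <;> by_cases hw : w Io.a = 0 ∧ ∀ j ∈ B Io, w j = 0
  · rw [if_pos hβ, if_pos hw, mul_one, if_pos]
    exact ⟨by rw [hβ.1, hw.1], fun j hj => by rw [hβ.2 j hj, hw.2 j hj]⟩
  · rw [if_pos hβ, if_neg hw, mul_zero, if_neg]
    rintro ⟨h1, h2⟩
    exact hw ⟨by have := hβ.1; omega, fun j hj => by have := h2 j hj; have := hβ.2 j hj; omega⟩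
  · rw [if_neg hβ, zero_mul, if_neg]
    rintro ⟨h1, h2⟩
    exact hβ ⟨by omega, fun j hj => by have := h2 j hj; omega⟩
  · rw [if_neg hβ, zero_mul, if_neg]
    rintro ⟨h1, h2⟩
    exact hβ ⟨by omega, fun j hj => by have := h2 j hj; omega⟩

variable {m : ℕ}

/-- `corr_hsd` — technical lemma of the R8 one-sided dilated free-lift toolkit. [folklore] -/
theorem corr_hsd (c d : Fin m → σ → ℂ) (b : σ → ℕ) : R6b.HSD Unit (corr Io c d b) := by
  refine ⟨fun β _ => corr Io c d b β, fun _ w => if (∀ j, w j = 0) then 1 else 0, fun β w => ?_⟩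
  rw [Fintype.sum_unique]
  dsimp only
  unfold corr
  by_cases hβ : ∀ j, β j = 0
  · by_cases hw : ∀ j, w j = 0
    · rw [if_pos hw, if_pos hβ, mul_one, if_pos]
      intro j; rw [Pi.add_apply, hβ j, hw j]
    · rw [if_neg hw, mul_zero, if_neg]
      intro h; apply hw; intro j; have := h j; rw [Pi.add_apply] at this; omega
  · rw [if_neg hβ, zero_mul, if_neg]
    intro h; apply hβ; intro j; have := h j; rw [Pi.add_apply] at this; omega

/-- Each `(j, k)` term has shift rank `≤ Σ_B b + 1`. [folklore] -/
theorem mainTerm_hsd (c d : Fin m → σ → ℂ) (b : σ → ℕ) (j : Fin m ⊕ Fin m) (k : ℕ) :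
    R6b.HSD (Fin (sB Io b + 1)) (mainTerm Io c d b j k) := by
  by_cases hk : Adm Io b k
  · have h1 := hsd_choose Io (Bk Io b k - 1) (Bk Io b k) (sB Io b) (Bk_le Io hk)
    have h2 := R6b.HSD.homMul (restProd_add Io (tab c d j)) h1
    have h3 := h2.constMul (mainConst Io c d b j k)
    unfold mainTerm
    exact h3
  · refine ⟨fun _ _ => 0, fun _ _ => 0, fun β w => ?_⟩
    unfold mainTerm
    rw [mainConst_eq_zero Io c d hk j, zero_mul]
    simp

/-- The slice index set for total plus-mass `s` (`|SIdx m s| = 2 m (s + 1)^2 + 1`). [folklore] -/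
abbrev SIdx (m s : ℕ) := ((Fin m ⊕ Fin m) × (Fin (s + 1) × Fin (s + 1))) ⊕ Unit

/-- `card_SIdx` — technical lemma of the R8 one-sided dilated free-lift toolkit. [folklore] -/
theorem card_SIdx (m s : ℕ) : Fintype.card (SIdx m s) = 2 * m * (s + 1) ^ 2 + 1 := by
  simp only [SIdx, Fintype.card_sum, Fintype.card_prod, Fintype.card_fin, Fintype.card_unit]
  ring

/-- **Finite shift rank of the slice functions.** [folklore] -/
theorem Fsl_hsd (c d : Fin m → σ → ℂ) (b : σ → ℕ) : R6b.HSD (SIdx m (sB Io b)) (Fsl Io c d b) := by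
  have hmain : R6b.HSD ((Fin m ⊕ Fin m) × (Fin (sB Io b + 1) × Fin (sB Io b + 1)))
      (fun ν => ∑ j : Fin m ⊕ Fin m, ∑ k : Fin (sB Io b + 1), mainTerm Io c d b j k ν) :=
    R6b.HSD.sum _ fun j => R6b.HSD.sum (fun (k : Fin (sB Io b + 1)) ν => mainTerm Io c d b j k ν)
      fun k => mainTerm_hsd Io c d b j k
  have h := (R6b.HSD.homMul (ind_add Io) hmain).add (corr_hsd Io c d b)
  unfold Fsl
  exact h

/-- The shift decomposition, unpacked. [folklore] -/
theorem Fsl_shift (c d : Fin m → σ → ℂ) (b : σ → ℕ) :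
    ∃ (col : (σ → ℕ) → SIdx m (sB Io b) → ℂ) (ch : SIdx m (sB Io b) → (σ → ℕ) → ℂ),
      ∀ β w : σ → ℕ, Fsl Io c d b (β + w) = ∑ i, col β i * ch i w :=
  Fsl_hsd Io c d b

end ShiftDecomp

/-! ## Part T7: the planar instance — one-sided relation data `p•α = Σ_j qI j • enum j`, the lift of the chain, the `p`-DILATED letter
push-forward `enumP`, injectivity on the lifted support from rank-one coincidences, lifted visible points, letter weights -/

section FreePlanar
open Summit.ValiantsHypothesis.ValiantsHypothesis.Theorems.NewtonUnitEquations.TwoProducts.FormalLogLinearisation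
open Summit.ValiantsHypothesis.ValiantsHypothesis.Theorems.NewtonUnitEquations.TwoProducts.PlanarCell

/-- The image of the plus-side coefficient vector under the substitution is `p` times itself. [folklore] -/
theorem piT_frM_ofFun : piT (frM Io) (ofFun Io.qf) = Io.p • ofFun Io.qf := by
  ext j
  rw [Finsupp.smul_apply, smul_eq_mul, ofFun_apply]
  by_cases hja : j = Io.a
  · rw [hja, piT_frM_a, Io.hqa, mul_zero]
  by_cases hjB : j ∈ B Io
  · rw [piT_frM_B Io _ hjB, ofFun_apply, ofFun_apply, Io.hqa, mul_zero, zero_add]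
  · have hjq : Io.qf j = 0 := by rw [mem_B] at hjB; push Not at hjB; exact hjB
    rw [piT_frM_other Io _ hja hjq, ofFun_apply, hjq, mul_zero]

variable {m : ℕ}
variable (u v : Fin m → MvPolynomial (Fin 2) ℂ)

/-- **Planar one-sided relation data**: a tail letter `α` with coefficient `p ≥ 1` and a plus-side coefficient vector `qI` on the tail
letters (`qI = 0` at `α`, not identically zero) with `p • α = Σ_j qI j • enum j`. [folklore] -/
structure RelDataO where
  /-- the lone letter `α` -/
  α : Expo
  /-- the coefficient of `α` -/
  p : ℕ
  hp : 1 ≤ p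
  hα : α ∈ tailSupport u v
  /-- the plus-side coefficients on the tail letters -/
  qI : Fin (sE u v) → ℕ
  hqa : qI (idxOf u v α hα) = 0
  hne : ∃ j, qI j ≠ 0
  hrel : p • α = ∑ j, qI j • enum u v j

variable {u v}
variable (Do : RelDataO u v)

/-- The index data of the relation. [folklore] -/
def RelDataO.idx : OIdx (Fin (sE u v)) where
  a := idxOf u v Do.α Do.hα
  qf := Do.qI
  p := Do.p
  hp := Do.hp
  hqa := Do.hqa
  hne := Do.hne

/-- The lone index enumerates `α`. [folklore] -/
theorem RelDataO.enum_a : enum u v Do.idx.a = Do.α := enum_idxOf u v _ _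
/-- The coefficient vector of the index data. [folklore] -/
theorem RelDataO.idx_qf : Do.idx.qf = Do.qI := rfl
/-- The lone coefficient of the index data. [folklore] -/
theorem RelDataO.idx_p : Do.idx.p = Do.p := rfl

/-- The `p`-DILATED planar push-forward of the new letters: `Y_j ↦ enum j` on the plus letters, `Y_i ↦ p · enum i` otherwise. [folklore] -/
def RelDataO.enumP (i : Fin (sE u v)) : Expo := if Do.qI i ≠ 0 then enum u v i else Do.p • enum u v i

/-- The dilated push-forward at a plus letter. [folklore] -/
theorem RelDataO.enumP_B {i : Fin (sE u v)} (hi : i ∈ B Do.idx) : Do.enumP i = enum u v i := by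
  have h : Do.qI i ≠ 0 := (mem_B Do.idx i).1 hi
  unfold RelDataO.enumP; rw [if_pos h]

/-- The dilated push-forward off the plus letters. [folklore] -/
theorem RelDataO.enumP_other {i : Fin (sE u v)} (hi : Do.qI i = 0) : Do.enumP i = Do.p • enum u v i := by
  unfold RelDataO.enumP; rw [if_neg (by simpa using hi)]

/-- The weighted push-forward of a letter: `qI i • enumP i = qI i • enum i`. [folklore] -/
theorem RelDataO.qI_smul_enumP (i : Fin (sE u v)) : Do.qI i • Do.enumP i = Do.qI i • enum u v i := by
  by_cases hi : Do.qI i = 0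
  · rw [hi, zero_smul, zero_smul]
  · rw [Do.enumP_B ((mem_B Do.idx i).2 hi)]

/-- The dilated push-forward of a substituted letter is `p` times the letter: `π_{enumP} (frM i) = p · enum i`. [folklore] -/
theorem RelDataO.piE_enumP_frM (i : Fin (sE u v)) : piE Do.enumP (frM Do.idx i) = Do.p • enum u v i := by
  by_cases hia : i = Do.idx.a
  · subst hia
    rw [frM_a, piE_eq_sum, Do.enum_a, Do.hrel]
    refine Finset.sum_congr rfl fun j _ => ?_
    rw [ofFun_apply, Do.idx_qf, Do.qI_smul_enumP]
  by_cases hiB : i ∈ B Do.idx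
  · rw [frM_B Do.idx hiB, piE_eq_piT, piT_single, Do.enumP_B hiB, Do.idx_p]
  · have hiq : Do.qI i = 0 := by rw [mem_B] at hiB; push Not at hiB; exact hiB
    rw [frM_other Do.idx hia hiq, piE_eq_piT, piT_single, one_smul, Do.enumP_other hiq]

/-- Substitution composed with the dilated push-forward equals the `p`-dilation of the letter push-forward. [folklore] -/
theorem RelDataO.comp_eq : (fun i => piT Do.enumP (frM Do.idx i)) = fun i => piT (R7b.dilE Do.p) (enum u v i) := by
  funext i
  rw [← piE_eq_piT, Do.piE_enumP_frM, R7b.piT_dilE]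

/-- On exponents: dilated push-forward ∘ substitution = `p` · letter push-forward. [folklore] -/
theorem RelDataO.piE_enumP_piT (L : Fin (sE u v) →₀ ℕ) : piE Do.enumP (piT (frM Do.idx) L) = Do.p • piE (enum u v) L := by
  rw [piE_eq_piT, piE_eq_piT, piT_piT, Do.comp_eq, ← piT_piT, R7b.piT_dilE]

/-- On polynomials: dilated push-forward ∘ substitution = dilation ∘ letter push-forward. [folklore] -/
theorem RelDataO.phi_enumP_phiT (H : MvPolynomial (Fin (sE u v)) ℂ) :
    phi Do.enumP (phiT (frM Do.idx) H) = phi (R7b.dilE Do.p) (phi (enum u v) H) := by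
  rw [phi_eq_phiT, phi_eq_phiT, phi_eq_phiT, phiT_phiT, Do.comp_eq, ← phiT_phiT]

/-- The lift of the chain difference. [folklore] -/
def RelDataO.GT : MvPolynomial (Fin (sE u v)) ℂ := phiT (frM Do.idx) (liftG (cU u v) (cV u v))

/-- Its dilated push-forward is the `p`-dilation of the planar difference of products. [folklore] -/
theorem RelDataO.phi_GT : phi Do.enumP Do.GT = phi (R7b.dilE Do.p) (tailDiff u v) := by
  unfold RelDataO.GT
  rw [Do.phi_enumP_phiT, phi_liftG]

/-- Exponents of the lift are substituted chain exponents. [folklore] -/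
theorem RelDataO.exists_of_mem_support_GT (x : Fin (sE u v) →₀ ℕ) (hx : x ∈ Do.GT.support) :
    ∃ L ∈ (liftG (cU u v) (cV u v)).support, piT (frM Do.idx) L = x :=
  exists_of_mem_support_phiT (frM Do.idx) _ x hx

/-- Exponents of the lift vanish at the lone letter. [folklore] -/
theorem RelDataO.apply_a_of_mem_support_GT (x : Fin (sE u v) →₀ ℕ) (hx : x ∈ Do.GT.support) : x Do.idx.a = 0 := by
  obtain ⟨L, -, rfl⟩ := Do.exists_of_mem_support_GT x hx
  exact piT_frM_a Do.idx L

/-- The plus side of the relation as a letter multiset: `Σ_j qI j · [enum j]`. [folklore] -/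
def RelDataO.rhoP : Expo →₀ ℕ := Finsupp.mapDomain (enum u v) (ofFun Do.qI)

/-- **Injectivity from one-sided rank-one coincidences**, for the dilated push-forward. [folklore] -/
theorem RelDataO.injOn_of_rankOne (hu : ∀ j, coeff 0 (u j) = 0) (hv : ∀ j, coeff 0 (v j) = 0)
    (hR : RankOneCoincidences (fun j => (u j).support ∪ (v j).support) Do.rhoP (Finsupp.single Do.α Do.p)) :
    Set.InjOn (piE Do.enumP) ↑Do.GT.support := by
  classical
  set A : Fin m → Finset Expo := fun j => (u j).support ∪ (v j).support with hA
  have hcU : ∀ j i, cU u v j i ≠ 0 → enum u v i ∈ A j := fun j i h =>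
    Finset.mem_union_left _ (mem_support_iff.mpr h)
  have hcV : ∀ j i, cV u v j i ≠ 0 → enum u v i ∈ A j := fun j i h =>
    Finset.mem_union_right _ (mem_support_iff.mpr h)
  have key : ∀ κ ∈ (liftG (cU u v) (cV u v)).support,
      ∃ a ∈ tuples A, ∑ j, a j = piE (enum u v) κ ∧ msetT a = Finsupp.mapDomain (enum u v) κ := by
    intro κ hκ
    unfold liftG at hκ
    rcases Finset.mem_union.1 (support_sub _ _ _ hκ) with h | h
    · exact tuple_of_mem_support_prod u v hu hv A (cU u v) hcU κ h
    · exact tuple_of_mem_support_prod u v hu hv A (cV u v) hcV κ h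
  set ρp : Fin (sE u v) →₀ ℕ := ofFun Do.qI with hρp
  set ρm : Fin (sE u v) →₀ ℕ := Finsupp.single Do.idx.a Do.p with hρm
  have hmp : Finsupp.mapDomain (enum u v) ρp = Do.rhoP := rfl
  have hmm : Finsupp.mapDomain (enum u v) ρm = Finsupp.single Do.α Do.p := by
    rw [hρm, Finsupp.mapDomain_single, Do.enum_a]
  have hπρ : piT (frM Do.idx) ρp = piT (frM Do.idx) ρm := by
    rw [hρp, hρm, piT_single, frM_a, ← Do.idx_qf, piT_frM_ofFun]; rfl
  have hmapk : ∀ (k : ℕ) (L ρ : Fin (sE u v) →₀ ℕ),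
      Finsupp.mapDomain (enum u v) (L + k • ρ) = Finsupp.mapDomain (enum u v) L + k • Finsupp.mapDomain (enum u v) ρ := by
    intro k L ρ
    rw [Finsupp.mapDomain_add]
    congr 1
    exact map_nsmul (Finsupp.mapDomain.addMonoidHom (enum u v)) k ρ
  have cancel : ∀ (k : ℕ) (L L' : Fin (sE u v) →₀ ℕ), L + k • ρp = L' + k • ρm →
      piT (frM Do.idx) L = piT (frM Do.idx) L' := by
    intro k L L' h
    have := congrArg (piT (frM Do.idx)) h
    rw [piT_add, piT_add, piT_nsmul, piT_nsmul, hπρ] at this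
    exact add_right_cancel this
  intro x hx x' hx' hπ
  obtain ⟨L, hL, rfl⟩ := Do.exists_of_mem_support_GT x hx
  obtain ⟨L', hL', rfl⟩ := Do.exists_of_mem_support_GT x' hx'
  rw [Do.piE_enumP_piT, Do.piE_enumP_piT] at hπ
  replace hπ := PlanarCell.eq_of_nsmul_eq Do.hp hπ
  obtain ⟨a, ha, haS, haM⟩ := key L hL
  obtain ⟨b, hb, hbS, hbM⟩ := key L' hL'
  obtain ⟨k, hk⟩ := hR a ha b hb (by rw [haS, hbS]; exact hπ)
  rw [haM, hbM, ← hmp, ← hmm, ← hmapk, ← hmapk, ← hmapk, ← hmapk] at hk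
  rcases hk with hk | hk
  · exact cancel k L L' (Finsupp.mapDomain_injective (enum_injective u v) hk)
  · exact (cancel k L' L (Finsupp.mapDomain_injective (enum_injective u v) hk)).symm

/-- Visible points lift (over `p · l`) to strict `ξ`-maxima of the lifted support (under injectivity). [folklore] -/
theorem RelDataO.lifted_of_visible (hinj : Set.InjOn (piE Do.enumP) ↑Do.GT.support) (ξ : Fin 2 → ℝ) (l : Expo)
    (htop : IsStrictTop ξ ↑(tailDiff u v).support l) :
    ∃ x₀ : Fin (sE u v) →₀ ℕ, x₀ ∈ Do.GT.support ∧ piE Do.enumP x₀ = Do.p • l ∧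
      ∀ x ∈ Do.GT.support, x ≠ x₀ → wt ξ (piE Do.enumP x) < wt ξ (Do.p • l) := by
  have hsupp : phi Do.enumP Do.GT = phi (R7b.dilE Do.p) (tailDiff u v) := Do.phi_GT
  have hinjD : Set.InjOn (piE (R7b.dilE Do.p)) ↑(tailDiff u v).support := fun e _ e' _ h => by
    rw [R7b.piE_dilE, R7b.piE_dilE] at h; exact PlanarCell.eq_of_nsmul_eq Do.hp h
  obtain ⟨hl, hlt⟩ := htop
  have hl' : Do.p • l ∈ (phi Do.enumP Do.GT).support := by
    rw [hsupp, mem_support_iff, ← R7b.piE_dilE Do.p l, coeff_phi_of_injOn (R7b.dilE Do.p) _ hinjD l hl]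
    exact mem_support_iff.mp hl
  obtain ⟨x₀, hx₀, hπ⟩ := exists_of_mem_support_phi Do.enumP _ _ hl'
  refine ⟨x₀, hx₀, hπ, fun x hx hne => ?_⟩
  have hmem : piE Do.enumP x ∈ (phi (R7b.dilE Do.p) (tailDiff u v)).support := by
    rw [← hsupp, mem_support_iff, coeff_phi_of_injOn Do.enumP _ hinj x hx]
    exact mem_support_iff.mp hx
  obtain ⟨e, he, hπe⟩ := exists_of_mem_support_phi (R7b.dilE Do.p) _ _ hmem
  rw [R7b.piE_dilE] at hπe
  have hne' : e ≠ l := by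
    intro h; apply hne; apply hinj hx hx₀; rw [← hπe, h, hπ]
  have h1 := hlt e he hne'
  rw [← hπe, wt_nsmul, wt_nsmul]
  have hp : (0 : ℝ) < Do.p := by exact_mod_cast Do.hp
  exact mul_lt_mul_of_pos_left h1 hp

/-! ### The upstairs weights: the (dilated) letter weights themselves -/

/-- Letter weights `r_i = -wt ξ (enumP i) > 0`. [folklore] -/
def RelDataO.rWP (ξ : Fin 2 → ℝ) (i : Fin (sE u v)) : ℝ := -wt ξ (Do.enumP i)

/-- Positivity of the letter weights for a valid weight. [folklore] -/
theorem RelDataO.rWP_pos (ξ : Fin 2 → ℝ) (hval : ValidWeight u v ξ) (i : Fin (sE u v)) : 0 < Do.rWP ξ i := by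
  unfold RelDataO.rWP
  by_cases hiq : Do.qI i = 0
  · rw [Do.enumP_other hiq, wt_nsmul]
    have h1 := wt_enum_neg u v ξ hval i
    have hp : (1 : ℝ) ≤ Do.p := by exact_mod_cast Do.hp
    nlinarith
  · rw [Do.enumP_B ((mem_B Do.idx i).2 hiq)]; linarith [wt_enum_neg u v ξ hval i]

/-- The letter weight functional is minus the planar weight of the dilated push-forward. [folklore] -/
theorem RelDataO.lwt_rWP (ξ : Fin 2 → ℝ) (x : Fin (sE u v) →₀ ℕ) : lwt (Do.rWP ξ) x = -wt ξ (piE Do.enumP x) :=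
  lwt_eq_neg_wt ξ Do.enumP x

/-- Splitting a linear weight along the slices: `θ(x) = Σ_i θ_i x̂_i + Σ_{j ∈ B} θ_j x_j` for `x_a = 0`. [folklore] -/
theorem lwt_splitO (θ : σ → ℝ) (x : σ →₀ ℕ) (hx : x Io.a = 0) :
    lwt θ x = (∑ i, θ i * ((xhat Io x i : ℕ) : ℝ)) + ∑ j ∈ B Io, θ j * ((x j : ℕ) : ℝ) := by
  classical
  unfold lwt
  rw [sum_split Io, sum_split Io (fun i => θ i * ((xhat Io x i : ℕ) : ℝ)), xhat_a, hx]
  have hr : ∑ i ∈ rest Io, θ i * ((x i : ℕ) : ℝ) = ∑ i ∈ rest Io, θ i * ((xhat Io x i : ℕ) : ℝ) := by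
    refine Finset.sum_congr rfl fun j hj => ?_
    rw [xhat_rest Io x hj]
  have hB : ∑ i ∈ B Io, θ i * ((xhat Io x i : ℕ) : ℝ) = 0 :=
    Finset.sum_eq_zero fun j hj => by rw [xhat_B Io x hj]; simp
  rw [hr, hB]
  push_cast
  ring

end FreePlanar

end R8
end Summit.ValiantsHypothesis.ValiantsHypothesis.Theorems.NewtonUnitEquations.TwoProducts.PermutationType

end
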